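import Literature.MathematicalPhysics.QuantumFieldTheory.ConstructiveQFTWave0Proofs
import Literature.MathematicalPhysics.QuantumFieldTheory.LatticeGaugeProofs
import HarnessLib

/-!
# Rectangular Wilson loops on the torus: line holonomies, translations, and the
Cauchy–Schwarz step of reflection positivity

Shared bookkeeping for the proof that the torus Wilson states satisfy the reflection-positivity
("log-convexity") inequalities between rectangular Wilson loop expectations,
`⟨W_{n×m}⟩² ≤ ⟨W_{(n-1)×m}⟩ ⟨W_{(n+1)×m}⟩`, used by
`Literature.MathematicalPhysics.QuantumFieldTheory.StringTension.hasStringTension_of_eventually`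
(existence of the static potential and of the string tension of infinite-volume limit states,
named fact `exists_hasStringTension` of `LatticeGauge`). Everything here is proved; no
definition is a named fact.

## Contents

* Algebra of Wave 0's straight-line holonomies `lineHolonomy U k n y` on the torus
  `(ℤ/Lℤ)^d`: concatenation (`lineHolonomy_add`, `lineHolonomy_succ_right`), dependence on the
  links of the line only (`lineHolonomy_congr`), entry-measurability through a continuous matrix
  representation (`entryMeasurable_lineHolonomy`), behaviour under torus translations
  (`lineHolonomy_torusConfigShift`, `rectangleHolonomy_torusConfigShift`) and hence
  **translation invariance of the torus loop expectations**
  (`wilsonExpectation_wilsonLoop_eq_zero_base`, from the tree's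
  `wilsonExpectation_comp_torusConfigShift`).
* `StringTension.re_sq_le_mul_of_nonneg_quadratic` — the purely algebraic Cauchy–Schwarz step:
  if a Hermitian-type expression `a + conj t · b + t · c + |t|² · e` is `≥ 0` in `ℂ` for all real
  `t` and all purely imaginary `t`, then `(Re b)² ≤ Re a · Re e`. This is how the
  positive-semidefiniteness of the reflection-positive form on the two-dimensional span of two
  staple observables yields `W(h₁+h₂+1)² ≤ W(2h₁+1) W(2h₂+1)` (Seiler LNP 159 §2;
  Osterwalder–Seiler 1978 §2).

## References

* E. Seiler, LNP 159 (1982), §2; K. Osterwalder, E. Seiler, Ann. Phys. 110 (1978) 440, §2.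
-/

noncomputable section

open MeasureTheory Finset Complex
open scoped ComplexOrder

namespace Literature.MathematicalPhysics.QuantumFieldTheory

/-! ### Line holonomies -/

section Lines

variable {d L : ℕ} {G : Type*} [Group G]

/-- The empty line has holonomy `1`. [folklore] -/
@[simp] theorem lineHolonomy_zero (U : GaugeConfig d L G) (k : Fin d) (y : Site d L) :
    lineHolonomy U k 0 y = 1 := rfl

/-- One more step at the beginning of a line. [folklore] -/
theorem lineHolonomy_succ (U : GaugeConfig d L G) (k : Fin d) (n : ℕ) (y : Site d L) :
    lineHolonomy U k (n + 1) y = U (y, k) * lineHolonomy U k n (y.shift k) := rfl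

/-- `y + eₖ + m eₖ = y + (m+1) eₖ` on the torus. [folklore] -/
theorem shift_add_single (y : Site d L) (k : Fin d) (m : ℕ) :
    y.shift k + Pi.single k ((m : ℕ) : ZMod L) = y + Pi.single k (((m + 1 : ℕ)) : ZMod L) := by
  simp only [Site.shift, add_assoc, ← Pi.single_add]
  congr 2
  push_cast
  ring

/-- **Concatenation of lines**: `m + n` steps from `y` are `m` steps from `y` followed by `n`
steps from `y + m eₖ`. [folklore] -/
theorem lineHolonomy_add (U : GaugeConfig d L G) (k : Fin d) (m n : ℕ) (y : Site d L) :
    lineHolonomy U k (m + n) y =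
      lineHolonomy U k m y * lineHolonomy U k n (y + Pi.single k ((m : ℕ) : ZMod L)) := by
  induction m generalizing y with
  | zero => simp
  | succ m ih =>
      rw [Nat.succ_add, lineHolonomy_succ, lineHolonomy_succ, ih (y.shift k), mul_assoc,
        shift_add_single]

/-- One more step at the end of a line. [folklore] -/
theorem lineHolonomy_succ_right (U : GaugeConfig d L G) (k : Fin d) (n : ℕ) (y : Site d L) :
    lineHolonomy U k (n + 1) y =
      lineHolonomy U k n y * U (y + Pi.single k ((n : ℕ) : ZMod L), k) := by
  rw [lineHolonomy_add, lineHolonomy_succ, lineHolonomy_zero, mul_one]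

/-- A line holonomy only depends on the links of the line. [folklore] -/
theorem lineHolonomy_congr {U V : GaugeConfig d L G} (k : Fin d) :
    ∀ (n : ℕ) (y : Site d L),
      (∀ s : ℕ, s < n → U (y + Pi.single k ((s : ℕ) : ZMod L), k) =
        V (y + Pi.single k ((s : ℕ) : ZMod L), k)) →
      lineHolonomy U k n y = lineHolonomy V k n y
  | 0, _, _ => rfl
  | n + 1, y, h => by
      rw [lineHolonomy_succ, lineHolonomy_succ]
      have h0 := h 0 (Nat.succ_pos n)
      simp only [Nat.cast_zero, Pi.single_zero, add_zero] at h0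
      rw [h0, lineHolonomy_congr k n (y.shift k) fun s hs => ?_]
      have := h (s + 1) (by omega)
      rwa [← shift_add_single] at this

/-- Line holonomies of a translated configuration. [folklore] -/
theorem lineHolonomy_torusConfigShift [MeasurableSpace G] (v : Site d L) (U : GaugeConfig d L G)
    (k : Fin d) : ∀ (n : ℕ) (y : Site d L),
      lineHolonomy (torusConfigShift v U) k n y = lineHolonomy U k n (y - v)
  | 0, _ => rfl
  | n + 1, y => by
      rw [lineHolonomy_succ, lineHolonomy_succ, torusConfigShift_apply,
        lineHolonomy_torusConfigShift v U k n]
      simp only [Site.shift, add_sub_right_comm]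

/-- Rectangle holonomies of a translated configuration. [folklore] -/
theorem rectangleHolonomy_torusConfigShift [MeasurableSpace G] (v : Site d L)
    (U : GaugeConfig d L G) (x : Site d L) (i j : Fin d) (R T : ℕ) :
    rectangleHolonomy (torusConfigShift v U) x i j R T = rectangleHolonomy U (x - v) i j R T := by
  simp only [rectangleHolonomy, lineHolonomy_torusConfigShift, add_sub_right_comm]

/-- The Wilson loop observable of a translated configuration is the Wilson loop at the
translated base point. [folklore] -/
theorem wilsonLoop_torusConfigShift [MeasurableSpace G] {N : ℕ} (ρ : G →* Matrix (Fin N) (Fin N) ℂ)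
    (v : Site d L) (x : Site d L) (i j : Fin d) (R T : ℕ) (U : GaugeConfig d L G) :
    wilsonLoop ρ x i j R T (torusConfigShift v U) = wilsonLoop ρ (x - v) i j R T U := by
  simp only [wilsonLoop, rectangleHolonomy_torusConfigShift]

/-- **Translation invariance of the torus loop expectations**: the expectation of a rectangular
Wilson loop does not depend on its base point (the torus Wilson state is translation invariant,
`wilsonMeasure_map_torusConfigShift`). [folklore] -/
theorem wilsonExpectation_wilsonLoop_eq_zero_base {N : ℕ} [NeZero L] [TopologicalSpace G]
    [IsTopologicalGroup G] [CompactSpace G] [MeasurableSpace G] [BorelSpace G]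
    (ρ : G →* Matrix (Fin N) (Fin N) ℂ) (β : ℝ) (x : Site d L) (i j : Fin d) (R T : ℕ) :
    wilsonExpectation ρ β (wilsonLoop ρ x i j R T) =
      wilsonExpectation ρ β (wilsonLoop ρ (0 : Site d L) i j R T) := by
  rw [← wilsonExpectation_comp_torusConfigShift ρ β x (wilsonLoop ρ x i j R T)]
  congr 1
  funext U
  simp only [Function.comp_apply, wilsonLoop_torusConfigShift, sub_self]

end Lines

/-! ### Entry-measurability of line holonomies -/

section Measurability

variable {d L N : ℕ} {G : Type*} [Group G] [TopologicalSpace G] [IsTopologicalGroup G]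
  [MeasurableSpace G] [BorelSpace G] {τ : G →* Matrix (Fin N) (Fin N) ℂ}

omit [TopologicalSpace G] [IsTopologicalGroup G] [BorelSpace G] in
/-- The constant `1` is entry-measurable. [folklore] -/
theorem WilsonRP.entryMeasurable_one {ι : Type*} :
    WilsonRP.EntryMeasurable τ (fun _ : ι → G => (1 : G)) := fun k l => by
  simp only [map_one]
  exact measurable_const

omit [IsTopologicalGroup G] in
/-- Line holonomies are entry-measurable through a continuous matrix representation (products
of link variables inside the representation; no second countability of `G` is needed).
[folklore] -/
theorem entryMeasurable_lineHolonomy (hτ : Continuous τ) (k : Fin d) :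
    ∀ (n : ℕ) (y : Site d L),
      WilsonRP.EntryMeasurable τ fun U : GaugeConfig d L G => lineHolonomy U k n y
  | 0, _ => WilsonRP.entryMeasurable_one
  | n + 1, y =>
      (WilsonRP.entryMeasurable_apply hτ (y, k)).mul (entryMeasurable_lineHolonomy hτ k n (y.shift k))

/-- The inverse of a line holonomy is entry-measurable. [folklore] -/
theorem entryMeasurable_lineHolonomy_inv (hτ : Continuous τ) (k : Fin d) :
    ∀ (n : ℕ) (y : Site d L),
      WilsonRP.EntryMeasurable τ fun U : GaugeConfig d L G => (lineHolonomy U k n y)⁻¹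
  | 0, _ => by simpa using (WilsonRP.entryMeasurable_one (τ := τ) (ι := Edge d L))
  | n + 1, y => by
      have h : (fun U : GaugeConfig d L G => (lineHolonomy U k (n + 1) y)⁻¹) =
          fun U => (lineHolonomy U k n (y.shift k))⁻¹ * (U (y, k))⁻¹ := by
        funext U; rw [lineHolonomy_succ, mul_inv_rev]
      rw [h]
      exact (entryMeasurable_lineHolonomy_inv hτ k n _).mul (WilsonRP.entryMeasurable_apply_inv hτ _)

end Measurability

/-! ### The Cauchy–Schwarz step -/

namespace StringTension

/-- **Cauchy–Schwarz from positive semidefiniteness on a two-dimensional span (real-part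
form).** Let `a, b, c, e ∈ ℂ` be such that the Hermitian-type expressions
`a + t (b + c) + t² e` (`t` real) and `a + i u (c - b) + u² e` (`u` real) are `≥ 0` in `ℂ`
(real and non-negative) — as they are when `a = B(φ,φ)`, `b = B(φ,ψ)`, `c = B(ψ,φ)`,
`e = B(ψ,ψ)` for a sesquilinear form with `B(φ + tψ, φ + tψ) ≥ 0`, `t ∈ ℝ ∪ iℝ`. Then
`Re c = Re b` and `(Re b)² ≤ Re a · Re e`. [folklore] -/
theorem re_sq_le_mul_of_nonneg_quadratic {a b c e : ℂ}
    (h₁ : ∀ t : ℝ, 0 ≤ a + (t : ℂ) * (b + c) + (t : ℂ) ^ 2 * e)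
    (h₂ : ∀ u : ℝ, 0 ≤ a + I * (u : ℂ) * (c - b) + (u : ℂ) ^ 2 * e) :
    b.re ^ 2 ≤ a.re * e.re := by
  have hsq : ∀ u : ℝ, ((u : ℂ) ^ 2).re = u ^ 2 ∧ ((u : ℂ) ^ 2).im = 0 := fun u => by
    rw [← Complex.ofReal_pow]; exact ⟨Complex.ofReal_re _, Complex.ofReal_im _⟩
  -- `Re c = Re b` from the imaginary parts at `u = ± 1`
  have him : ∀ u : ℝ, a.im + u * (c.re - b.re) + u ^ 2 * e.im = 0 := fun u => by
    have h := (Complex.nonneg_iff.1 (h₂ u)).2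
    have hi : (a + I * (u : ℂ) * (c - b) + (u : ℂ) ^ 2 * e).im =
        a.im + u * (c.re - b.re) + u ^ 2 * e.im := by
      simp only [Complex.add_im, Complex.mul_im, Complex.mul_re, Complex.I_re, Complex.I_im,
        Complex.ofReal_re, Complex.ofReal_im, Complex.sub_re, Complex.sub_im, (hsq u).1,
        (hsq u).2]
      ring
    rw [hi] at h
    linarith
  have hcb : c.re = b.re := by
    have h1 := him 1
    have h2 := him (-1)
    linarith
  -- the real quadratic `Re a + 2 t Re b + t² Re e ≥ 0`
  have hre : ∀ t : ℝ, 0 ≤ e.re * (t * t) + (2 * b.re) * t + a.re := fun t => by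
    have h := (Complex.nonneg_iff.1 (h₁ t)).1
    have hr : (a + (t : ℂ) * (b + c) + (t : ℂ) ^ 2 * e).re =
        a.re + t * (b.re + c.re) + t ^ 2 * e.re := by
      simp only [Complex.add_re, Complex.mul_re, Complex.ofReal_re, Complex.ofReal_im,
        Complex.add_im, (hsq t).1, (hsq t).2]
      ring
    rw [hr, hcb] at h
    nlinarith [h]
  have hd := discrim_le_zero hre
  unfold discrim at hd
  nlinarith [hd]

end StringTension

end Literature.MathematicalPhysics.QuantumFieldTheory
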